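import Mathlib
import Summits.Ventures.PercRepro2.A3CutExpand
import Summits.Ventures.PercRepro2.A3CutGcLoop

/-!
# (HCOV) for all graphs reduces to the instances where `a₃` is not behind a cut vertex
(blind cell PercRepro2, night-1 g32; proofs/NIGHT1-G32.md §6 (E4′))

`BehindCut ends o a₁ a₂ a₃ b`: `a₃` lies on the far side of a cut vertex `x` separating it from the four
marks, with at least one non-loop edge on its side.  By the pendant-part expansion (`HCov_cut_of_leafRow_loopA`
when `x` is unmarked, `HCov_pendantPart_mark` when `x` is a mark) and a strong induction on the number of
non-loop edges (looping the part's edges at `x` removes at least one), (HCOV) at every vertex of every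
instance follows from (HCOV) at the vertices that are NOT behind a cut vertex together with p1's row 2′LEAF
at the unmarked vertices (`HCov_of_leafRow_of_notBehindCut`; `HCov_all_of_leafRow_of_notBehindCut` in the
`_all` form).  Standard axioms.
-/

namespace Summit.Ventures.PercRepro2

open UnionCluster CovForm CutV

namespace CovForm

namespace A3Fibre

section PendantReduction

variable {V : Type*} {E : Type*} [Fintype V] [DecidableEq V] [Fintype E] [DecidableEq E]
  {R : Type*} [Field R] [LinearOrder R] [IsStrictOrderedRing R]

/-- `a₃` lies behind a cut vertex `x` that separates it from the four marks, with at least one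
non-loop edge on its side. -/
def BehindCut (ends : E → Sym2 V) (o a₁ a₂ a₃ b : V) : Prop :=
  ∃ (x : V) (VA VB : Finset V) (EA EB : Set E), IsCut ends x ↑VA ↑VB EA EB ∧ a₃ ∈ VA ∧
    o ∈ insert x VB ∧ a₁ ∈ insert x VB ∧ a₂ ∈ insert x VB ∧ b ∈ insert x VB ∧
    ∃ e ∈ EA, ¬ (ends e).IsDiag

omit [Fintype V] [DecidableEq E] in
/-- Looping the `A`-edges at `x` removes at least one non-loop edge when `EA` holds one. -/
lemma card_nonLoop_loopA_lt {ends : E → Sym2 V} {EA : Set E} [DecidablePred (· ∈ EA)] {x : V}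
    (he : ∃ e ∈ EA, ¬ (ends e).IsDiag) :
    (Finset.univ.filter fun e => ¬ ((loopA ends EA x) e).IsDiag).card <
      (Finset.univ.filter fun e => ¬ (ends e).IsDiag).card := by
  apply Finset.card_lt_card
  rw [Finset.ssubset_iff_of_subset]
  · obtain ⟨e, heA, hne⟩ := he
    refine ⟨e, ?_, ?_⟩
    · simp only [Finset.mem_filter, Finset.mem_univ, true_and]
      exact hne
    · simp only [Finset.mem_filter, Finset.mem_univ, true_and, not_not, loopA, if_pos heA]
      exact Sym2.mk_isDiag_iff.2 rfl
  · intro e he'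
    simp only [Finset.mem_filter, Finset.mem_univ, true_and] at he' ⊢
    intro hd
    apply he'
    unfold loopA
    split_ifs with h
    · exact Sym2.mk_isDiag_iff.2 rfl
    · exact hd

/-- **The pendant-part reduction of (HCOV).** For a fixed weight `p`: if row 2′LEAF holds at every
unmarked vertex of every graph on `(V, E)` and (HCOV) holds at every vertex that is not behind a cut
vertex, then (HCOV) holds everywhere. -/
theorem HCov_of_leafRow_of_notBehindCut (p : E → R) (hp : IsProbVec p)
    (hrow : ∀ (ends : E → Sym2 V) (o a₁ a₂ x b : V), a₁ ≠ a₂ → a₁ ≠ x → a₂ ≠ x → o ≠ a₁ →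
      o ≠ a₂ → o ≠ x → o ≠ b → b ≠ a₁ → b ≠ a₂ → b ≠ x → LeafStep.LeafRow p ends o a₁ a₂ x b)
    (hbase : ∀ (ends : E → Sym2 V) (o a₁ a₂ a₃ b : V), a₁ ≠ a₂ → a₁ ≠ a₃ → a₂ ≠ a₃ → o ≠ a₁ →
      o ≠ a₂ → o ≠ a₃ → o ≠ b → b ≠ a₁ → b ≠ a₂ → b ≠ a₃ → ¬ BehindCut ends o a₁ a₂ a₃ b →
      HCov p ends o a₁ a₂ a₃ b)
    (ends : E → Sym2 V) (o a₁ a₂ a₃ b : V) (h12 : a₁ ≠ a₂) (h13 : a₁ ≠ a₃) (h23 : a₂ ≠ a₃)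
    (ho1 : o ≠ a₁) (ho2 : o ≠ a₂) (ho3 : o ≠ a₃) (hob : o ≠ b) (hb1 : b ≠ a₁) (hb2 : b ≠ a₂)
    (hb3 : b ≠ a₃) : HCov p ends o a₁ a₂ a₃ b := by
  suffices H : ∀ n : ℕ, ∀ (ends : E → Sym2 V) (a₃ : V),
      (Finset.univ.filter fun e => ¬ (ends e).IsDiag).card = n → a₁ ≠ a₃ → a₂ ≠ a₃ → o ≠ a₃ →
      b ≠ a₃ → HCov p ends o a₁ a₂ a₃ b from H _ ends a₃ rfl h13 h23 ho3 hb3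
  intro n
  induction n using Nat.strong_induction_on with
  | _ n ih =>
    intro ends a₃ hn h13 h23 ho3 hb3
    by_cases hB : BehindCut ends o a₁ a₂ a₃ b
    · obtain ⟨x, VA, VB, EA, EB, h, h3, ho, h1, h2, hb, he⟩ := hB
      classical
      by_cases hx : x = o ∨ x = b ∨ x = a₁ ∨ x = a₂
      · exact HCov_pendantPart_mark hp h hx ho h1 h2 hb h3
      · simp only [not_or] at hx
        have hlt := card_nonLoop_loopA_lt (x := x) he
        rw [hn] at hlt
        have hIH := ih _ hlt (loopA ends EA x) x rfl (Ne.symm hx.2.2.1) (Ne.symm hx.2.2.2)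
          (Ne.symm hx.1) (Ne.symm hx.2.1)
        exact HCov_cut_of_leafRow_loopA hp h h3 ho h1 h2 hb hIH
          (hrow _ _ _ _ _ _ h12 (Ne.symm hx.2.2.1) (Ne.symm hx.2.2.2) ho1 ho2 (Ne.symm hx.1) hob
            hb1 hb2 (Ne.symm hx.2.1))
    · exact hbase ends o a₁ a₂ a₃ b h12 h13 h23 ho1 ho2 ho3 hob hb1 hb2 hb3 hB

end PendantReduction

end A3Fibre

section Closure

variable (R : Type*) [Field R] [LinearOrder R] [IsStrictOrderedRing R]

/-- **Row 2′LEAF for every finite graph** at every unmarked vertex (p1's open row, `_all` form). -/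
def LeafRow_all : Prop :=
  ∀ (V E : Type) [Fintype V] [DecidableEq V] [Fintype E] [DecidableEq E]
    (ends : E → Sym2 V) (p : E → R), IsProbVec p →
    ∀ o a₁ a₂ x b : V, a₁ ≠ a₂ → a₁ ≠ x → a₂ ≠ x → o ≠ a₁ → o ≠ a₂ → o ≠ x → o ≠ b →
      b ≠ a₁ → b ≠ a₂ → b ≠ x → LeafStep.LeafRow p ends o a₁ a₂ x b

/-- **(HCOV) for every finite graph at every `a₃` that is not behind a cut vertex.** -/
def HCovNotBehindCut_all : Prop :=
  ∀ (V E : Type) [Fintype V] [DecidableEq V] [Fintype E] [DecidableEq E]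
    (ends : E → Sym2 V) (p : E → R), IsProbVec p →
    ∀ o a₁ a₂ a₃ b : V, a₁ ≠ a₂ → a₁ ≠ a₃ → a₂ ≠ a₃ → o ≠ a₁ → o ≠ a₂ → o ≠ a₃ → o ≠ b →
      b ≠ a₁ → b ≠ a₂ → b ≠ a₃ → ¬ A3Fibre.BehindCut ends o a₁ a₂ a₃ b → HCov p ends o a₁ a₂ a₃ b

/-- **(HCOV) for all graphs from row 2′LEAF and (HCOV) off the pendant parts.** -/
theorem HCov_all_of_leafRow_of_notBehindCut (hrow : LeafRow_all R) (hbase : HCovNotBehindCut_all R) :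
    HCov_all R := by
  intro V E _ _ _ _ ends p hp o a₁ a₂ a₃ b h12 h13 h23 ho1 ho2 ho3 hob hb1 hb2 hb3
  exact A3Fibre.HCov_of_leafRow_of_notBehindCut p hp (fun ends' => hrow V E ends' p hp)
    (fun ends' => hbase V E ends' p hp) ends o a₁ a₂ a₃ b h12 h13 h23 ho1 ho2 ho3 hob hb1 hb2 hb3

end Closure

end CovForm

end Summit.Ventures.PercRepro2
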